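import Summits.QuantumAdvantage.QuantumAdvantage.Theorems.HolonomyDialLaws

/-!
# HolonomyDial — Plant (cell decomp-qadv, seat lens-2, generation 13; supports item 26531 `ExactnessDial.PolyLossOddU3`)

§K first half: two-window planting `plant`, walk bookkeeping (`walk_agree`, `walk_block`, `Wtot_pair`, `hol_pair`), sign products `winSign`/`maskSign` (sections PlantSigns, PairSigns).

Split (≤ 400 lines, part 3/11) of the node file `HOME/decomp-qadv-lens-2/g13/HolonomyDial.lean` (v5, sha256 fb2c0281…,
farm rc 0, no placeholders); declarations verbatim, namespace `Summit.QuantumAdvantage.QuantumAdvantage.Theorems.HolonomyDial`.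
Record: NODE-g13.md.
-/

set_option linter.dupNamespace false

noncomputable section
open scoped Classical

namespace Summit.QuantumAdvantage.QuantumAdvantage.Theorems

open Finset
open Literature.Computability.QuantumComplexity Literature.Computability.QuantumComplexity.RingHLF
open Literature.Computability.MetaComplexity Literature.Computability.MetaComplexity.Smolensky
open Summit.QuantumAdvantage.AdviceFreeQNC0
open Summit.QuantumAdvantage.QuantumAdvantage.Theses (ExactnessDial.PolyLossOddU3 ExactnessDial.NoPerfectOdd3
  ExactnessDial.NoPerfectConst3 ExactnessDial.MassStep3u ExactnessDial.OddToAll3 ExactnessDial.DPLift3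
  ExactnessDial.MultiRingBridge3 ExactnessDial.closes)

namespace HolonomyDial

/-! ## §K The bottom rung is a THEOREM: decoding the holonomy is parity-hard

Two-window PLANTING.  For `N = m + 3 + m + t` plant `x = [w ⊕ r] [μ] [w ⊕ r'] [ctx]` with a 3-bit middle
block `μ`.  Two middle blocks `μ_A, μ_B` of equal zero-parity give patterns `x_A, x_B` in the same parity
class whose walks agree before and re-synchronise after the block, and whose total weights differ by
`W(x_A) - W(x_B) = 1 - 2·[P]`, `P` = the zero-parity of the first window `w ⊕ r` (`Wtot_pair`).  Hence
two correct decodings give `V(x_A) - V(x_B) = (-1)^m χ(r)·χ(w)` with `χ = Π 2^{wᵢ}` Smolensky's character of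
order 2 over `𝔽₃` (`winSign_eq`), i.e. a degree-`D` polynomial in `w` agreeing with `χ`; Smolensky's bound
(`card_filter_omMono_eq_le`) caps the agreement at `2^{m-1} + D·C(m,⌊m/2⌋) ≤ 3·2^{m-2}` once `16 D² ≤ m`, and
averaging over the masks (`r, r', ctx` enter only through injective re-randomisation) gives
`#{x odd : V x ≠ hol x} ≥ 2^{N-6}` (`holDecode_hard`), whence `HolDecodeLoss3` with `C = 1` (`holDecodeLoss3`).
-/

section Decoding

variable {m t : ℕ}

/-- the planted pattern `[w ⊕ r] [μ] [w ⊕ r'] [ctx]` of length `m + 3 + m + t`. -/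
def plant (μ : Fin 3 → Bool) (w r r' : Fin m → Bool) (ctx : Fin t → Bool) : Fin (m + 3 + m + t) → Bool :=
  fun j =>
    if h₁ : j.val < m then xor (w ⟨j.val, h₁⟩) (r ⟨j.val, h₁⟩)
    else if h₂ : j.val < m + 3 then μ ⟨j.val - m, by omega⟩
    else if h₃ : j.val < m + 3 + m then xor (w ⟨j.val - (m + 3), by omega⟩) (r' ⟨j.val - (m + 3), by omega⟩)
    else ctx ⟨j.val - (m + 3 + m), by have := j.isLt; omega⟩

section PlantAPI

variable (μ : Fin 3 → Bool) (w r r' : Fin m → Bool) (ctx : Fin t → Bool)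

/-- Ring-game helper `plant_apply_lt` (lens-2 law package; see the module docstring). -/
theorem plant_apply_lt (j : Fin (m + 3 + m + t)) (h : j.val < m) :
    plant μ w r r' ctx j = xor (w ⟨j.val, h⟩) (r ⟨j.val, h⟩) := by
  unfold plant; rw [dif_pos h]

/-- Ring-game helper `plant_apply_mid` (lens-2 law package; see the module docstring). -/
theorem plant_apply_mid (j : Fin (m + 3 + m + t)) (h₁ : ¬ j.val < m) (h₂ : j.val < m + 3) :
    plant μ w r r' ctx j = μ ⟨j.val - m, by omega⟩ := by
  unfold plant; rw [dif_neg h₁, dif_pos h₂]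

/-- Ring-game helper `plant_apply_win2` (lens-2 law package; see the module docstring). -/
theorem plant_apply_win2 (j : Fin (m + 3 + m + t)) (h₂ : ¬ j.val < m + 3) (h₃ : j.val < m + 3 + m) :
    plant μ w r r' ctx j = xor (w ⟨j.val - (m + 3), by omega⟩) (r' ⟨j.val - (m + 3), by omega⟩) := by
  unfold plant; rw [dif_neg (by omega), dif_neg h₂, dif_pos h₃]

/-- Ring-game helper `plant_apply_ctx` (lens-2 law package; see the module docstring). -/
theorem plant_apply_ctx (j : Fin (m + 3 + m + t)) (h₃ : ¬ j.val < m + 3 + m) :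
    plant μ w r r' ctx j = ctx ⟨j.val - (m + 3 + m), by have := j.isLt; omega⟩ := by
  unfold plant; rw [dif_neg (by omega), dif_neg (by omega), dif_neg h₃]

/-- Fin-indexed evaluation: first window. -/
theorem plant_at₁ (i : Fin m) (j : Fin (m + 3 + m + t)) (hj : j.val = i.val) :
    plant μ w r r' ctx j = xor (w i) (r i) := by
  rw [plant_apply_lt μ w r r' ctx j (by omega)]
  have hi : (⟨j.val, (by omega : j.val < m)⟩ : Fin m) = i := Fin.ext hj
  rw [hi]

/-- middle block. -/
theorem plant_at₂ (i : Fin 3) (j : Fin (m + 3 + m + t)) (hj : j.val = m + i.val) :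
    plant μ w r r' ctx j = μ i := by
  rw [plant_apply_mid μ w r r' ctx j (by omega) (by omega)]
  have hi : (⟨j.val - m, (by omega : j.val - m < 3)⟩ : Fin 3) = i := Fin.ext (by simp only; omega)
  rw [hi]

/-- second window. -/
theorem plant_at₃ (i : Fin m) (j : Fin (m + 3 + m + t)) (hj : j.val = m + 3 + i.val) :
    plant μ w r r' ctx j = xor (w i) (r' i) := by
  rw [plant_apply_win2 μ w r r' ctx j (by omega) (by omega)]
  have hi : (⟨j.val - (m + 3), (by omega : j.val - (m + 3) < m)⟩ : Fin m) = i := Fin.ext (by simp only; omega)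
  rw [hi]

/-- context. -/
theorem plant_at₄ (i : Fin t) (j : Fin (m + 3 + m + t)) (hj : j.val = m + 3 + m + i.val) :
    plant μ w r r' ctx j = ctx i := by
  rw [plant_apply_ctx μ w r r' ctx j (by omega)]
  have hi : (⟨j.val - (m + 3 + m), (by omega : j.val - (m + 3 + m) < t)⟩ : Fin t) = i :=
    Fin.ext (by simp only; omega)
  rw [hi]

/-- two plantings with different middle blocks agree off the middle block. -/
theorem plant_agree_off (μ' : Fin 3 → Bool) (j : Fin (m + 3 + m + t)) (h : j.val < m ∨ m + 3 ≤ j.val) :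
    plant μ w r r' ctx j = plant μ' w r r' ctx j := by
  unfold plant
  rcases h with h | h
  · rw [dif_pos h, dif_pos h]
  · simp only [dif_neg (show ¬ j.val < m by omega), dif_neg (show ¬ j.val < m + 3 by omega)]

/-- the masks are recovered from the planted pattern (injectivity in `(r, r', ctx)` for fixed `w`). -/
theorem plant_inj {μ₁ μ₂ : Fin 3 → Bool} {r₁ r₁' r₂ r₂' : Fin m → Bool} {c₁ c₂ : Fin t → Bool}
    (h : plant μ₁ w r₁ r₁' c₁ = plant μ₂ w r₂ r₂' c₂) : r₁ = r₂ ∧ r₁' = r₂' ∧ c₁ = c₂ := by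
  refine ⟨?_, ?_, ?_⟩
  · funext i
    have := congrFun h ⟨i.val, by omega⟩
    rw [plant_at₁ μ₁ w r₁ r₁' c₁ i _ rfl, plant_at₁ μ₂ w r₂ r₂' c₂ i _ rfl] at this
    revert this; cases w i <;> cases r₁ i <;> cases r₂ i <;> decide
  · funext i
    have := congrFun h ⟨m + 3 + i.val, by omega⟩
    rw [plant_at₃ μ₁ w r₁ r₁' c₁ i _ rfl, plant_at₃ μ₂ w r₂ r₂' c₂ i _ rfl] at this
    revert this; cases w i <;> cases r₁' i <;> cases r₂' i <;> decide
  · funext i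
    have := congrFun h ⟨m + 3 + m + i.val, by omega⟩
    rwa [plant_at₄ μ₁ w r₁ r₁' c₁ i _ rfl, plant_at₄ μ₂ w r₂ r₂' c₂ i _ rfl] at this

end PlantAPI

/-! ### walk locality -/

/-- **walk locality**: two patterns with the same zero-parity at `b` that agree on `[b, K)` have the same prefix
parities on `[b, K]` and their weights grow by the same amount there. -/
theorem walk_agree {N : ℕ} (x x' : Fin N → Bool) (b K : ℕ) (hK : K ≤ N) (hpar : zpar x b = zpar x' b)
    (hag : ∀ j : Fin N, b ≤ j.val → j.val < K → x j = x' j) :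
    ∀ k, b ≤ k → k ≤ K → zpar x k = zpar x' k ∧ Wk x k + Wk x' b = Wk x' k + Wk x b := by
  intro k hbk hkK
  induction k, hbk using Nat.le_induction with
  | base => exact ⟨hpar, by rw [add_comm]⟩
  | succ k hbk ih =>
    have hk : k < N := by omega
    obtain ⟨ihz, ihW⟩ := ih (by omega)
    have hxk : x ⟨k, hk⟩ = x' ⟨k, hk⟩ := hag ⟨k, hk⟩ hbk (by simp only; omega)
    have hz : zpar x (k + 1) = zpar x' (k + 1) := by
      rw [zpar_succ x hk, zpar_succ x' hk, ihz, hxk]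
    refine ⟨hz, ?_⟩
    rw [Wk_succ x hk, Wk_succ x' hk, uCoord_eq_zpar, uCoord_eq_zpar]
    simp only [hz]
    omega

/-- through a 3-block starting at `a`: the three prefix parities and the weight increment. -/
theorem walk_block {N : ℕ} (x : Fin N → Bool) (a : ℕ) (ha : a + 3 ≤ N) :
    zpar x (a + 1) = xor (zpar x a) (!x ⟨a, by omega⟩) ∧
    zpar x (a + 2) = xor (xor (zpar x a) (!x ⟨a, by omega⟩)) (!x ⟨a + 1, by omega⟩) ∧
    zpar x (a + 3) = xor (xor (xor (zpar x a) (!x ⟨a, by omega⟩)) (!x ⟨a + 1, by omega⟩)) (!x ⟨a + 2, by omega⟩) ∧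
    Wk x (a + 3) = Wk x a + (if zpar x (a + 1) then 1 else 0) + (if zpar x (a + 2) then 1 else 0) +
      (if zpar x (a + 3) then 1 else 0) := by
  have h1 : zpar x (a + 1) = xor (zpar x a) (!x ⟨a, by omega⟩) := zpar_succ x (by omega)
  have h2 : zpar x (a + 2) = xor (zpar x (a + 1)) (!x ⟨a + 1, by omega⟩) := zpar_succ x (by omega)
  have h3 : zpar x (a + 3) = xor (zpar x (a + 2)) (!x ⟨a + 2, by omega⟩) := zpar_succ x (by omega)
  refine ⟨h1, by rw [h2, h1], by rw [h3, h2, h1], ?_⟩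
  have W1 : Wk x (a + 1) = Wk x a + (if uCoord x ⟨a, by omega⟩ = true then 1 else 0) := Wk_succ x (by omega)
  have W2 : Wk x (a + 2) = Wk x (a + 1) + (if uCoord x ⟨a + 1, by omega⟩ = true then 1 else 0) :=
    Wk_succ x (by omega)
  have W3 : Wk x (a + 3) = Wk x (a + 2) + (if uCoord x ⟨a + 2, by omega⟩ = true then 1 else 0) :=
    Wk_succ x (by omega)
  rw [W3, W2, W1, uCoord_eq_zpar, uCoord_eq_zpar, uCoord_eq_zpar]

/-! ### the two admissible middle pairs -/

/-- middle blocks: class `false` (even number of zeros) `001 / 111`, class `true` (odd) `101 / 110`. -/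
def muA (κ : Bool) : Fin 3 → Bool := if κ then ![true, false, true] else ![false, false, true]
/-- see `muA`. -/
def muB (κ : Bool) : Fin 3 → Bool := if κ then ![true, true, false] else ![true, true, true]

section Pair

variable (w r r' : Fin m → Bool) (ctx : Fin t → Bool)

/-- the planted pair. -/
def xA (κ : Bool) : Fin (m + 3 + m + t) → Bool := plant (muA κ) w r r' ctx
/-- see `xA`. -/
def xB (κ : Bool) : Fin (m + 3 + m + t) → Bool := plant (muB κ) w r r' ctx

/-- **holonomy shift of the planted pair**: `W(x_A) + 2[P] = W(x_B) + 1` where `P` is the zero-parity of the first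
window (common to both). -/
theorem Wtot_pair (hm : 1 ≤ m) (κ : Bool) :
    Wtot (xA w r r' ctx κ) + (if zpar (xA w r r' ctx κ) m then 2 else 0) = Wtot (xB w r r' ctx κ) + 1 := by
  set xa := xA w r r' ctx κ with hxa
  set xb := xB w r r' ctx κ with hxb
  -- prefix
  have hpre := walk_agree xa xb 0 m (by omega) (by rw [zpar_zero, zpar_zero])
    (fun j _ hj => plant_agree_off _ w r r' ctx _ j (Or.inl hj)) m (Nat.zero_le m) le_rfl
  rw [Wk_zero, Wk_zero] at hpre
  obtain ⟨hPm, hWm⟩ := hpre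
  -- block
  obtain ⟨a1, a2, a3, aW⟩ := walk_block xa m (by omega)
  obtain ⟨b1, b2, b3, bW⟩ := walk_block xb m (by omega)
  have va0 : xa ⟨m, by omega⟩ = muA κ 0 := plant_at₂ _ w r r' ctx 0 _ (by simp)
  have va1 : xa ⟨m + 1, by omega⟩ = muA κ 1 := plant_at₂ _ w r r' ctx 1 _ (by simp)
  have va2 : xa ⟨m + 2, by omega⟩ = muA κ 2 := plant_at₂ _ w r r' ctx 2 _ (by simp)
  have vb0 : xb ⟨m, by omega⟩ = muB κ 0 := plant_at₂ _ w r r' ctx 0 _ (by simp)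
  have vb1 : xb ⟨m + 1, by omega⟩ = muB κ 1 := plant_at₂ _ w r r' ctx 1 _ (by simp)
  have vb2 : xb ⟨m + 2, by omega⟩ = muB κ 2 := plant_at₂ _ w r r' ctx 2 _ (by simp)
  rw [va0] at a1; rw [va0, va1] at a2; rw [va0, va1, va2] at a3
  rw [vb0] at b1; rw [vb0, vb1] at b2; rw [vb0, vb1, vb2] at b3
  -- block parities agree after the block
  have hsync : zpar xa (m + 3) = zpar xb (m + 3) := by
    rw [a3, b3, ← hPm]
    cases zpar xa m <;> cases κ <;> simp [muA, muB]
  -- suffix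
  have hsuf := walk_agree xa xb (m + 3) (m + 3 + m + t) le_rfl hsync
    (fun j hj _ => plant_agree_off _ w r r' ctx _ j (Or.inr hj)) (m + 3 + m + t - 1) (by omega) (by omega)
  obtain ⟨-, hW⟩ := hsuf
  unfold Wtot
  simp only [add_zero] at hWm
  rw [aW, bW, a1, a2, a3, b1, b2, b3, ← hPm, ← hWm] at hW
  revert hW
  generalize zpar xa m = P
  cases P <;> cases κ <;> simp [muA, muB] <;> omega

/-- in `𝔽₃`: `hol(x_A) - hol(x_B) = (P ? -1 : 1)`. -/
theorem hol_pair (hm : 1 ≤ m) (κ : Bool) :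
    ((hol (xA w r r' ctx κ) : ℕ) : ZMod 3) - ((hol (xB w r r' ctx κ) : ℕ) : ZMod 3) =
      if zpar (xA w r r' ctx κ) m then -1 else 1 := by
  have h := Wtot_pair w r r' ctx hm κ
  unfold hol
  rw [ZMod.natCast_mod, ZMod.natCast_mod]
  have hc := congrArg (Nat.cast : ℕ → ZMod 3) h
  split_ifs at hc ⊢ with hP
  · push_cast at hc ⊢
    linear_combination hc
  · push_cast at hc ⊢
    linear_combination hc

end Pair

/-! ### parity bookkeeping by sign products -/

/-- Ring-game helper `prod_sign_eq_pow` (lens-2 law package; see the module docstring). -/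
theorem prod_sign_eq_pow {α : Type*} (s : Finset α) (p : α → Prop) [DecidablePred p] :
    (∏ i ∈ s, (if p i then (-1 : ZMod 3) else 1)) = (-1) ^ (s.filter p).card := by
  rw [Finset.prod_ite, Finset.prod_const_one, mul_one, Finset.prod_const]

/-- Ring-game helper `neg_one_pow_eq_ite` (lens-2 law package; see the module docstring). -/
theorem neg_one_pow_eq_ite (c : ℕ) : ((-1 : ZMod 3)) ^ c = if c % 2 = 1 then -1 else 1 := by
  rcases Nat.even_or_odd c with ⟨k, rfl⟩ | ⟨k, rfl⟩
  · rw [if_neg (by omega), ← two_mul, pow_mul]; simp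
  · rw [if_pos (by omega), pow_succ, pow_mul]; simp

/-- Ring-game helper `sq_sign_prod` (lens-2 law package; see the module docstring). -/
theorem sq_sign_prod {α : Type*} (S : Finset α) (p : α → Prop) [DecidablePred p] :
    (∏ i ∈ S, (if p i then (-1 : ZMod 3) else 1)) ^ 2 = 1 := by
  rw [← Finset.prod_pow]
  exact Finset.prod_eq_one fun i _ => by split_ifs <;> decide

/-- the odd class as a sign condition. -/
theorem oddZeros_iff_prod {N : ℕ} (x : Fin N → Bool) :
    OddZeros x ↔ (∏ j, (if x j = false then (-1 : ZMod 3) else 1)) = -1 := by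
  rw [prod_sign_eq_pow, neg_one_pow_eq_ite, OddZeros]
  by_cases h : (univ.filter fun j : Fin N => x j = false).card % 2 = 1
  · simp [h]
  · simp only [h, if_false, false_iff]; decide

/-- a prefix parity as a sign. -/
theorem zpar_sign {N : ℕ} (x : Fin N → Bool) (k : ℕ) :
    (if zpar x k then (-1 : ZMod 3) else 1) = ∏ j, (if (j.val < k ∧ x j = false) then (-1 : ZMod 3) else 1) := by
  rw [prod_sign_eq_pow, neg_one_pow_eq_ite, zpar]
  by_cases h : (univ.filter fun j : Fin N => j.val < k ∧ x j = false).card % 2 = 1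
  · simp [h]
  · simp [h]

/-- window sign `Π_i s(w_i ⊕ r_i)`, `s(0) = -1`, `s(1) = 1`. -/
def winSign (r w : Fin m → Bool) : ZMod 3 := ∏ i, (if xor (w i) (r i) = false then (-1 : ZMod 3) else 1)

/-- mask sign `Π_i (-1)^{[r_i ≠ r'_i]}`. -/
def maskSign (r r' : Fin m → Bool) : ZMod 3 := ∏ i, (if xor (r i) (r' i) = true then (-1 : ZMod 3) else 1)

/-- `Π_i s(w_i ⊕ r_i) = (-1)^m χ(r) χ(w)` with `χ = omMono 2 univ` (Smolensky's character of order 2 over `𝔽₃`). -/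
theorem winSign_eq (r w : Fin m → Bool) :
    winSign r w = (-1) ^ m * omMono (2 : ZMod 3) univ r * omMono (2 : ZMod 3) univ w := by
  unfold winSign omMono
  have key : ∀ a b : Bool, (if xor a b = false then (-1 : ZMod 3) else 1) =
      (-1) * ((if b then (2 : ZMod 3) else 1) * (if a then (2 : ZMod 3) else 1)) := by decide
  simp_rw [key]
  rw [Finset.prod_mul_distrib, Finset.prod_mul_distrib, Finset.prod_const, Finset.card_univ, Fintype.card_fin]
  ring

/-- the product of the two window signs does not depend on `w`. -/
theorem winSign_mul (r r' w : Fin m → Bool) : winSign r w * winSign r' w = maskSign r r' := by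
  unfold winSign maskSign
  rw [← Finset.prod_mul_distrib]
  refine Finset.prod_congr rfl fun i _ => ?_
  have key : ∀ a b c : Bool, (if xor a b = false then (-1 : ZMod 3) else 1) *
      (if xor a c = false then (-1 : ZMod 3) else 1) = (if xor b c = true then (-1 : ZMod 3) else 1) := by decide
  exact key (w i) (r i) (r' i)

section PlantSigns

variable (μ : Fin 3 → Bool) (w r r' : Fin m → Bool) (ctx : Fin t → Bool)

/-- block decomposition of a sign product over the planted pattern. -/
theorem prod_plant (φ : ℕ → Bool → ZMod 3) :
    (∏ j : Fin (m + 3 + m + t), φ j.val (plant μ w r r' ctx j)) =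
      (∏ i : Fin m, φ i.val (xor (w i) (r i))) * (∏ i : Fin 3, φ (m + i.val) (μ i)) *
        (∏ i : Fin m, φ (m + 3 + i.val) (xor (w i) (r' i))) * ∏ i : Fin t, φ (m + 3 + m + i.val) (ctx i) := by
  rw [Fin.prod_univ_add, Fin.prod_univ_add, Fin.prod_univ_add]
  congr 1; congr 1; congr 1
  · refine Finset.prod_congr rfl fun i _ => ?_
    rw [plant_at₁ μ w r r' ctx i _ (by simp)]
    simp
  · refine Finset.prod_congr rfl fun i _ => ?_
    rw [plant_at₂ μ w r r' ctx i _ (by simp)]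
    simp
  · refine Finset.prod_congr rfl fun i _ => ?_
    rw [plant_at₃ μ w r r' ctx i _ (by simp)]
    simp
  · refine Finset.prod_congr rfl fun i _ => ?_
    rw [plant_at₄ μ w r r' ctx i _ (by simp)]
    simp

/-- the sign of a planting factors; the `w`-dependence cancels. -/
theorem odd_plant_sign :
    (∏ j : Fin (m + 3 + m + t), (if plant μ w r r' ctx j = false then (-1 : ZMod 3) else 1)) =
      maskSign r r' * ((∏ i : Fin 3, (if μ i = false then (-1 : ZMod 3) else 1)) *
        ∏ i : Fin t, (if ctx i = false then (-1 : ZMod 3) else 1)) := by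
  have h := prod_plant μ w r r' ctx (fun _ b => if b = false then (-1 : ZMod 3) else 1)
  rw [h, ← winSign_mul r r' w]
  unfold winSign
  ring

/-- the first-window parity sign of a planting is `(-1)^m χ(r) χ(w)`. -/
theorem zpar_plant_sign :
    (if zpar (plant μ w r r' ctx) m then (-1 : ZMod 3) else 1) =
      (-1) ^ m * omMono (2 : ZMod 3) univ r * omMono (2 : ZMod 3) univ w := by
  rw [zpar_sign, ← winSign_eq r w]
  have h := prod_plant μ w r r' ctx (fun j b => if (j < m ∧ b = false) then (-1 : ZMod 3) else 1)
  rw [h]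
  have e1 : (∏ i : Fin m, (if (i.val < m ∧ xor (w i) (r i) = false) then (-1 : ZMod 3) else 1)) = winSign r w := by
    unfold winSign
    refine Finset.prod_congr rfl fun i _ => ?_
    simp [i.isLt]
  have e2 : (∏ i : Fin 3, (if (m + i.val < m ∧ μ i = false) then (-1 : ZMod 3) else 1)) = 1 :=
    Finset.prod_eq_one fun i _ => if_neg fun h => absurd h.1 (by omega)
  have e3 : (∏ i : Fin m, (if (m + 3 + i.val < m ∧ xor (w i) (r' i) = false) then (-1 : ZMod 3) else 1)) = 1 :=
    Finset.prod_eq_one fun i _ => if_neg fun h => absurd h.1 (by omega)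
  have e4 : (∏ i : Fin t, (if (m + 3 + m + i.val < m ∧ ctx i = false) then (-1 : ZMod 3) else 1)) = 1 :=
    Finset.prod_eq_one fun i _ => if_neg fun h => absurd h.1 (by omega)
  rw [e1, e2, e3, e4]
  ring

/-- the parity class of a planting does not depend on `w`. -/
theorem odd_plant_indep (w₀ : Fin m → Bool) :
    OddZeros (plant μ w r r' ctx) ↔ OddZeros (plant μ w₀ r r' ctx) := by
  rw [oddZeros_iff_prod, oddZeros_iff_prod, odd_plant_sign, odd_plant_sign]

end PlantSigns

section PairSigns

variable (w r r' : Fin m → Bool) (ctx : Fin t → Bool)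

/-- the pair lies in one parity class. -/
theorem odd_xB_iff (κ : Bool) : OddZeros (xB w r r' ctx κ) ↔ OddZeros (xA w r r' ctx κ) := by
  unfold xA xB
  rw [oddZeros_iff_prod, oddZeros_iff_prod, odd_plant_sign, odd_plant_sign]
  have h : (∏ i : Fin 3, (if muB κ i = false then (-1 : ZMod 3) else 1)) =
      ∏ i : Fin 3, (if muA κ i = false then (-1 : ZMod 3) else 1) := by cases κ <;> decide
  rw [h]

/-- flipping the class bit flips the parity class. -/
theorem odd_xA_flip : OddZeros (xA w r r' ctx true) ↔ ¬ OddZeros (xA w r r' ctx false) := by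
  unfold xA
  rw [oddZeros_iff_prod, oddZeros_iff_prod, odd_plant_sign, odd_plant_sign]
  have hA : (∏ i : Fin 3, (if muA true i = false then (-1 : ZMod 3) else 1)) = -1 := by decide
  have hB : (∏ i : Fin 3, (if muA false i = false then (-1 : ZMod 3) else 1)) = 1 := by decide
  rw [hA, hB]
  have h1 := sq_sign_prod (univ : Finset (Fin m)) (fun i => xor (r i) (r' i) = true)
  have h2 := sq_sign_prod (univ : Finset (Fin t)) (fun i => ctx i = false)
  unfold maskSign
  generalize (∏ i : Fin m, (if xor (r i) (r' i) = true then (-1 : ZMod 3) else 1)) = a at h1 ⊢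
  generalize (∏ i : Fin t, (if ctx i = false then (-1 : ZMod 3) else 1)) = b at h2 ⊢
  revert a b
  decide

end PairSigns
end Decoding

end HolonomyDial

end Summit.QuantumAdvantage.QuantumAdvantage.Theorems
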